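import Literature.Topology.FourManifolds.TrisectionEuler
import Literature.Topology.FourManifolds.TrisectionsRefutation
import Literature.Topology.FourManifolds.MorseEulerEqualities
import Literature.AlgebraicTopology.SingularHomology.CechEulerCharacteristic
import Literature.AlgebraicTopology.SingularHomology.CechTautness
import Literature.AlgebraicTopology.SingularHomology.RationalEulerCharacteristic
import Literature.AlgebraicTopology.SingularHomology.HomologySpheresProofs
import Literature.AlgebraicTopology.Homotopy.CWTypeCompactBoundaryProofs
import Literature.Geometry.Manifold.TopologicalEmbedding
import Mathlib.Analysis.Normed.Module.Connected
import HarnessLib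

/-!
# Proofs for `TrisectionEuler.lean`: the Euler-characteristic fact over `IsTrisection` holds vacuously

Sibling proof file of `Literature/Topology/FourManifolds/TrisectionEuler.lean` (D-0014: named facts
`def X : Prop` are discharged as `theorem X_holds : X`; fact item
`provefact-Literature.Topology.FourManifolds.trisection_genus_eq_sum_of_homotopyEquiv_sphere`).

It records `Literature.Topology.FourManifolds.trisection_genus_eq_sum_of_homotopyEquiv_sphere_holds`:
the named fact `trisection_genus_eq_sum_of_homotopyEquiv_sphere` — *a closed oriented smooth
4-manifold `X` homotopy equivalent to `S⁴` with a `(g; k₀, k₁, k₂)`-trisection `S : Fin 3 → Set X`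
in the sense of `Literature.Topology.FourManifolds.IsTrisection` has `g = k₀ + k₁ + k₂`* — holds.

**Source.** Gay–Kirby 2016, Remark 2 (right after Def. 1; arXiv TeX checked, p. 2 of
arXiv:1205.1565v3 = p. 3098 of the journal): "Note that the triple intersection `X₁ ∩ X₂ ∩ X₃` is
a surface of genus `g` and that `χ(X) = 2 + g − 3k`. Thus `k` is determined by `X` and `g`";
Meier–Schirmer–Zupan 2016, Remark 3.12 (unbalanced form, "any trisection of `S⁴` must satisfy
`g = k₁ + k₂ + k₃`"); Abrams–Gay–Kirby 2018, proof of Cor. 4 (`χ` of a homotopy 4-sphere is `2`).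

**How, and a warning.** The fact quantifies over a hypothesis `IsTrisection X g k S`, and that
vendored predicate is unsatisfiable for every `X`, `g`, `k`, `S`
(`Literature.Topology.FourManifolds.TrisectionRefutation.not_isTrisection`, `TrisectionsRefutation.lean`:
its clause (ii) makes the three sectors smoothly embedded manifolds *with boundary* meeting pairwise
along their boundaries at the points of the non-empty central surface, which is impossible to first
order — three pairwise disjoint open half-spaces of `ℝ⁴` — whereas Gay–Kirby's sectors `Xᵢ ≅ Z_k`
have *corners* along the central surface `F_g`).  Hence the universally quantified statement holds
**vacuously**, and that is the proof given here; nothing of the printed remark (the handle count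
`1 − k₀ + (g − k₁) − k₂ + 1 = χ(X)` and the homotopy invariance of `χ`) is used or formalised.  The
mathematical content is carried by the corrected named fact
`Literature.Topology.FourManifolds.gkTrisection_genus_eq_sum_of_homotopyEquiv_sphere` (same file
`TrisectionEuler.lean`), stated over the satisfiable predicate
`Literature.Topology.FourManifolds.IsGKTrisection` (sectors with corners; the genus-`0` trisection of
the round `S⁴` satisfies it, `SphereTrisectionsSectors.lean`), which is **not** proved in the tree
(it needs the Euler characteristic of a closed 4-manifold, its computation from a handle
decomposition, and its homotopy invariance — none of which Mathlib or the tree has today).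
This is the same treatment as `TrisectionFunctorProofs.lean` gives the facts of
`TrisectionFunctor.lean` over `IsBalancedTrisection`.

The proved corollaries in the namespace `trisection_genus_eq_sum_of_homotopyEquiv_sphere`
(`.balanced`, `.homotopySphere`, `.le`, `.three_dvd`, `.exists_isBalancedTrisection_three_mul`)
can now be fed `trisection_genus_eq_sum_of_homotopyEquiv_sphere_holds` for their hypothesis `h`
(they are equally vacuous: each also consumes an `IsTrisection`/`IsBalancedTrisection` witness, or
the refuted fact `exists_isBalancedTrisection`, `TrisectionRefutation.not_exists_isBalancedTrisection`).

## References

* D. Gay, R. Kirby, *Trisecting 4-manifolds*, Geom. Topol. 20 (2016) 3097–3132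
  (arXiv:1205.1565): Def. 1 and Remark 2 (p. 3098). [GayKirby2016]
* J. Meier, T. Schirmer, A. Zupan, *Classification of trisections and the generalized property R
  conjecture*, Proc. AMS 144 (2016) 4983–4997 (arXiv:1507.06561): Remark 3.12.
  [MeierSchirmerZupan2016]
* A. Abrams, D. Gay, R. Kirby, *Group trisections and smooth 4-manifolds*, Geom. Topol. 22 (2018)
  1537–1545 (arXiv:1605.06731): Cor. 4 and its proof. [AbramsGayKirby2018]

# Part II (appended 2026-08-15): proof of Gay–Kirby's Remark 2 for homotopy 4-spheres over
# `IsGKTrisection` — discharge of `gkTrisection_genus_eq_sum_of_homotopyEquiv_sphere`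

The warning above ("**not** proved in the tree … none of which Mathlib or the tree has today") is
superseded by this part: the corrected fact IS now proved, below.  D. Gay, R. Kirby, *Trisecting
4-manifolds*, Geom. Topol. 20 (2016), Remark 2 (arXiv p. 3): *"the triple intersection
`X₁ ∩ X₂ ∩ X₃` is a surface of genus `g` and `χ(X) = 2 + g - 3k`"*; J. Meier, T. Schirmer,
A. Zupan (2016), Remark 3.12: *"any trisection of `S⁴` must satisfy `g = k₁ + k₂ + k₃`"*.  The
named fact `Literature.Topology.FourManifolds.gkTrisection_genus_eq_sum_of_homotopyEquiv_sphere`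
is its `χ`-free consequence for a closed oriented smooth `X ≃ S⁴` trisected in the sense of
`IsGKTrisection` (sectors with corners).  This file PROVES it
(`gkTrisection_genus_eq_sum_of_homotopyEquiv_sphere_holds`).

## The argument (inclusion–exclusion of Euler characteristics over the closed cover by sectors)

Gay–Kirby read `χ(X) = 2 + g - 3k` off the handle decomposition of their Thm. 4; we count
instead with the Euler characteristic `χ̌` of **Čech cohomology with rational coefficients** of
compact subsets of `X` (`Cech.euler`, `CechEulerCharacteristic.lean`), which is additive over
unions of compact sets by the (proved) Čech Mayer–Vietoris sequence (`Cech.euler_union₃`):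

  `χ̌(X) = Σᵢ χ̌(Xᵢ) - Σ_{i<j} χ̌(Xᵢ ∩ Xⱼ) + χ̌(X₁ ∩ X₂ ∩ X₃)`.

Each piece `K` (a sector `Xᵢ ≅ W` with one `0`-handle and `kᵢ` `1`-handles, a double
intersection `H_{ij}` = genus-`g` handlebody, the central surface `F = ∂H₁₂`, and `X` itself) is
compact with locally contractible subspace (a topological manifold, possibly with boundary), so
by **tautness** (`Cech.cechEquivOfLocallyContractibleSpace`, `CechTautness.lean`, from the proved
Euclidean-neighbourhood-retract theorem, `X` being embedded in some `ℝᵐ`) `Ȟ^p(K; ℚ)` is the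
singular cohomology `H^p(K; ℚ)`, whose alternating dimension count is the integral Euler
characteristic (`FinRelHomology.rat_cohomology`, `RationalEulerCharacteristic.lean`).  The
integral Euler characteristics come from the handle counts by the **Morse equalities**
(`IsMorseAdapted.finRelHomology_empty`, `…_boundary_manifold`, `MorseEulerEqualities.lean`):
`χ(W) = 1 - kᵢ`, `χ(H) = 1 - g`, `χ(∂H) = χ(H) - χ(H, ∂H) = 2 - 2g`; and `χ(X) = χ(S⁴) = 2` by
homotopy invariance and the homology of `S⁴` (`isHomologySphere_sphere`).  Hence
`2 = (3 - Σ kᵢ) - 3(1 - g) + (2 - 2g)`, i.e. `g = k₁ + k₂ + k₃`.  Only clauses (i) (cover),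
(ii) (sectors are embedded compact `1`-handlebodies) and (iii) (double intersections are embedded
genus-`g` handlebodies with boundary the triple intersection) of `IsGKTrisection` are used.

* `sum_neg_one_pow_mul_handleCount`, `…_rev` — the alternating counts of `handleCount 1 k`;
* `finCech_and_euler_of_homeomorph` — the per-piece passage `χ̌(K; ℚ) = χ(P; ℤ)` for `↥K ≃ₜ P`;
* `relEuler_of_handleCount`, `relEuler_boundary_of_handleCount` — `χ = 1 - k`,
  `χ(∂) = (1 - k)(1 + (-1)ⁿ)`;
* `finRelHomology_sphere_four`, `finRelHomology_of_homotopyEquiv_sphere_four` — `χ = 2`;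
* `gkTrisection_genus_eq_sum_of_homotopyEquiv_sphere_holds`.

Everything is proved; no named facts are introduced.

## References for Part II

* D. Gay, R. Kirby (2016), Remark 2 (arXiv:1205.1565, p. 3) and J. Meier, T. Schirmer,
  A. Zupan (2016), Remark 3.12, as above. [GayKirby2016] [MeierSchirmerZupan2016]
* A. Hatcher, *Algebraic Topology* (2002), Thm. 2.44, Cor. 2.14, §3.A Cor. 3A.6. [HatcherAT2002]
* E. H. Spanier, *Algebraic Topology* (1966), Ch. 6 §1 Thm. 10 (tautness). [Spanier1981]
-/

noncomputable section

open scoped Manifold ContDiff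

namespace Literature.Topology.FourManifolds

universe u

/-- **`trisection_genus_eq_sum_of_homotopyEquiv_sphere` holds — vacuously.** Gay–Kirby 2016,
Remark 2 (`χ(X) = 2 + g − 3k` for a `(g, k)`-trisected closed connected oriented 4-manifold;
unbalanced form `χ(X) = 2 + g − k₁ − k₂ − k₃`, Meier–Schirmer–Zupan Remark 3.12), specialised to
`X ≃ₕ S⁴` where `χ(X) = 2` (Abrams–Gay–Kirby, proof of Cor. 4), gives `g = k₀ + k₁ + k₂`.  The
proof uses only that the hypothesis `IsTrisection X g k S` is contradictory
(`TrisectionRefutation.not_isTrisection`: the vendored sectors are smoothly embedded manifolds with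
boundary, but Gay–Kirby's sectors have corners along the central surface), so the printed remark is
not formalised by this declaration; see `gkTrisection_genus_eq_sum_of_homotopyEquiv_sphere` for the
faithful restatement over `IsGKTrisection`. [cite: GayKirby2016, Remark 2 (p. 3098)]
[cite: MeierSchirmerZupan2016, Remark 3.12] [cite: AbramsGayKirby2018, Cor. 4] -/
theorem trisection_genus_eq_sum_of_homotopyEquiv_sphere_holds :
    trisection_genus_eq_sum_of_homotopyEquiv_sphere.{u} := by
  intro X _ _ _ _ _ _ _ g k S hS _
  exact (TrisectionRefutation.not_isTrisection hS).elim

/-! ## Part II — `gkTrisection_genus_eq_sum_of_homotopyEquiv_sphere` holds -/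

open scoped ContinuousMap
open Set Function CategoryTheory Limits
open _root_.Topology
open Literature.AlgebraicTopology.SingularHomology Literature.AlgebraicTopology.Homotopy

/-! ### The alternating counts of `handleCount 1 k` -/

/-- The alternating count `Σ_{j<n+2} (-1)^j c_j` of `handleCount 1 k` (one `0`-handle, `k`
`1`-handles, nothing else) is `1 - k`. [folklore] -/
theorem sum_neg_one_pow_mul_handleCount (n k : ℕ) :
    ∑ j ∈ Finset.range (n + 2), (-1 : ℤ) ^ j * (handleCount 1 k j : ℤ) = 1 - k := by
  rw [Finset.sum_range_succ', Finset.sum_range_succ']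
  rw [Finset.sum_eq_zero fun j _ => by
    rw [handleCount_of_two_le 1 k (by omega : 2 ≤ j + 1 + 1), Nat.cast_zero, mul_zero]]
  simp [handleCount_zero, handleCount_one]
  ring

/-- The reversed alternating count `Σ_{j<n+2} (-1)^j c_{n+1-j}` of `handleCount 1 k` is
`(-1)^(n+1) (1 - k)`. [folklore] -/
theorem sum_neg_one_pow_mul_handleCount_rev (n k : ℕ) :
    ∑ j ∈ Finset.range (n + 2), (-1 : ℤ) ^ j * (handleCount 1 k (n + 1 - j) : ℤ) =
      (-1) ^ (n + 1) * (1 - k) := by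
  have hrefl := Finset.sum_range_reflect
    (fun i => (-1 : ℤ) ^ (n + 1 - i) * (handleCount 1 k i : ℤ)) (n + 2)
  have hlhs : ∑ j ∈ Finset.range (n + 2), (-1 : ℤ) ^ j * (handleCount 1 k (n + 1 - j) : ℤ) =
      ∑ j ∈ Finset.range (n + 2),
        (fun i => (-1 : ℤ) ^ (n + 1 - i) * (handleCount 1 k i : ℤ)) (n + 2 - 1 - j) := by
    refine Finset.sum_congr rfl fun j hj => ?_
    have hj' : j ≤ n + 1 := by simpa [Nat.lt_succ_iff] using Finset.mem_range.1 hj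
    simp only
    rw [show n + 2 - 1 - j = n + 1 - j by omega, show n + 1 - (n + 1 - j) = j by omega]
  rw [hlhs, hrefl, Finset.sum_range_succ', Finset.sum_range_succ']
  rw [Finset.sum_eq_zero fun j _ => by
    rw [handleCount_of_two_le 1 k (by omega : 2 ≤ j + 1 + 1), Nat.cast_zero, mul_zero]]
  simp only [handleCount_zero, handleCount_one, Nat.cast_one, mul_one, zero_add,
    Nat.sub_zero, show n + 1 - (0 + 1) = n by omega]
  rw [pow_succ]
  ring

/-! ### Euler characteristics of `1`-handlebodies and of their boundaries -/

section HandleCount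

variable {n : ℕ} {W : Type u} [TopologicalSpace W] [T2Space W] [SecondCountableTopology W]
  [CompactSpace W] [ChartedSpace (EuclideanHalfSpace (n + 1)) W] [IsManifold (𝓡∂ (n + 1)) ∞ W]

/-- **`χ(W) = 1 - k` for a `1`-handlebody with one `0`-handle and `k` `1`-handles**
(`HasHandleDecomposition n W (handleCount 1 k)`; the Morse equality
`IsMorseAdapted.finRelHomology_empty` of `MorseEulerEqualities.lean`, Matsumoto Cor. 4.19 /
Hirsch Thm. 6.3.4 (b)): `H_•(W; ℤ)` is finitely generated, vanishes from degree `n + 2` on, and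
`χ(W) = 1 - k`. [cite: HirschDT1976, Ch. 6 §3, Thm. 3.4 (b) (PDF p. 151)] -/
theorem relEuler_of_handleCount {k : ℕ} (h : HasHandleDecomposition n W (handleCount 1 k)) :
    FinRelHomology ℤ ℤ W ∅ (n + 2) ∧ relEuler ℤ ℤ W ∅ = 1 - k := by
  obtain ⟨f, hf, hcount⟩ := h
  obtain ⟨hA, hAe⟩ := hf.finRelHomology_empty ℤ ℤ
  refine ⟨hA, ?_⟩
  rw [hAe, Module.finrank_self, Nat.cast_one, mul_one, ← sum_neg_one_pow_mul_handleCount n k]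
  exact Finset.sum_congr rfl fun j _ => by rw [hcount j]

/-- **`χ(∂W) = (1 - k)(1 + (-1)^n)` for a `1`-handlebody `W` of dimension `n + 1` with one
`0`-handle and `k` `1`-handles** — `2 - 2k` in dimension `3` (the boundary of the genus-`k`
handlebody is the closed surface of Euler characteristic `2 - 2k`), `0` in dimension `4`: the
Morse equality for the boundary, `IsMorseAdapted.finRelHomology_boundary_manifold`
(`χ(∂W) = χ(W) - χ(W, ∂W)`, the relative count being the reversed one).  The integral homology of
`∂W` is finitely generated and vanishes from degree `n + 2` on.
[cite: MilnorHCobordism1965, §3–4 (dual decomposition, proof of Thm. 4.8)] -/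
theorem relEuler_boundary_of_handleCount {k : ℕ} (h : HasHandleDecomposition n W (handleCount 1 k)) :
    FinRelHomology ℤ ℤ ((𝓡∂ (n + 1)).boundary W) ∅ (n + 2) ∧
      relEuler ℤ ℤ ((𝓡∂ (n + 1)).boundary W) ∅ = (1 - k) * (1 + (-1) ^ n) := by
  obtain ⟨f, hf, hcount⟩ := h
  obtain ⟨hC, hCe⟩ := hf.finRelHomology_boundary_manifold ℤ ℤ
  refine ⟨hC, ?_⟩
  have h1 : ∑ j ∈ Finset.range (n + 2),
      (-1 : ℤ) ^ j * ((criticalSetOfIndex (𝓡∂ (n + 1)) f j).ncard : ℤ) = 1 - k := by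
    rw [← sum_neg_one_pow_mul_handleCount n k]
    exact Finset.sum_congr rfl fun j _ => by rw [hcount j]
  have h2 : ∑ j ∈ Finset.range (n + 2),
      (-1 : ℤ) ^ j * ((criticalSetOfIndex (𝓡∂ (n + 1)) f (n + 1 - j)).ncard : ℤ) =
      (-1) ^ (n + 1) * (1 - k) := by
    rw [← sum_neg_one_pow_mul_handleCount_rev n k]
    exact Finset.sum_congr rfl fun j _ => by rw [hcount (n + 1 - j)]
  rw [hCe, Module.finrank_self, Nat.cast_one, mul_one]
  simp only [mul_sub, Finset.sum_sub_distrib]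
  rw [h1, h2, pow_succ]
  ring

end HandleCount

/-! ### The rational Čech Euler characteristic of a compact piece with manifold topology -/

section Pieces

variable {X : Type u} [TopologicalSpace X]

/-- **The rational Čech Euler characteristic of a taut compact piece is its integral Euler
characteristic.**  Let `X` be embedded in `ℝᵐ` with image a neighbourhood retract, `K ⊆ X`
compact with `↥K ≃ₜ P` for a locally contractible `P` (in the universe of `X`) whose integral
homology is finitely generated and vanishes from degree `N` on.  Then the Čech cohomology
`Ȟ^•(K; ℚ)` is finite-dimensional, vanishes from degree `N` on, and `χ̌(K; ℚ) = χ(P; ℤ)`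
(tautness `Ȟ^p(K; ℚ) ≅ H^p(↥K; ℚ) ≅ H^p(P; ℚ)`, Spanier 1966, Thm. 6.1.10, the tree's
`Cech.cechEquivOfLocallyContractibleSpace`; then `dim_ℚ H^p(P; ℚ) = rank_ℤ H_p(P; ℤ)`,
Hatcher 2002, Cor. 3A.6 (a) / Thm. 3.2, the tree's `FinRelHomology.rat_cohomology`).
[cite: Spanier1981, Ch. 6 §1, Thm. 10] -/
theorem finCech_and_euler_of_homeomorph {m : ℕ} {ι : X → (Fin m → ℝ)} (hι : IsEmbedding ι)
    (hX : IsNeighbourhoodRetract (range ι)) {K : Set X} (hKc : IsCompact K)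
    {P : Type u} [TopologicalSpace P] (φ : ↥K ≃ₜ P) (hP : LocallyContractibleSpace P)
    {N : ℕ} (h : FinRelHomology ℤ ℤ P ∅ N) :
    Cech.FinCech ℚ (ModuleCat.of ℚ (ULift.{u} ℚ)) K N ∧
      Cech.euler ℚ (ModuleCat.of ℚ (ULift.{u} ℚ)) K = relEuler ℤ ℤ P ∅ := by
  have hKl : LocallyContractibleSpace K := locallyContractibleSpace_of_homeomorph φ.symm hP
  let e : ∀ p, Cech ℚ (ModuleCat.of ℚ (ULift.{u} ℚ)) K p ≃ₗ[ℚ] singularCohomology ℚ ℚ P p := fun p =>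
    (Cech.cechEquivOfLocallyContractibleSpace ℚ hι hX hKc hKl p).trans
      (singularCohomology.mapIso ℚ ℚ φ.symm p).toLinearEquiv
  obtain ⟨hfin, hzero, hsum⟩ := h.rat_cohomology
  have hF : Cech.FinCech ℚ (ModuleCat.of ℚ (ULift.{u} ℚ)) K N :=
    Cech.FinCech.of_linearEquiv e hfin fun p hp => ModuleCat.subsingleton_of_isZero (hzero p hp)
  exact ⟨hF, (hF.euler_eq_sum_of_linearEquiv e).trans hsum⟩

end Pieces

/-! ### `χ(S⁴) = 2`, and homotopy invariance across universes -/

/-- `rank_ℤ (ULift ℤ) = 1`. [folklore] -/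
theorem finrank_ulift_int : Module.finrank ℤ (ModuleCat.of ℤ (ULift.{u} ℤ)) = 1 := by
  rw [(ULift.moduleEquiv : ULift.{u} ℤ ≃ₗ[ℤ] ℤ).finrank_eq, Module.finrank_self]

/-- **`χ(S⁴) = 2`**: the integral homology of the round `S⁴ ⊆ ℝ⁵` is `ℤ, 0, 0, 0, ℤ, 0, …`
(Hatcher 2002, Cor. 2.14 and Prop. 2.7; the tree's PROVED `isHomologySphere_sphere` and
`singularHomology.isIso_ε_of_pathConnectedSpace`), so it is finitely generated, vanishes from
degree `5` on, and its Euler characteristic is `2`. [cite: HatcherAT2002, Cor. 2.14] -/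
theorem finRelHomology_sphere_four :
    FinRelHomology ℤ ℤ (Metric.sphere (0 : EuclideanSpace ℝ (Fin 5)) 1) ∅ 5 ∧
      relEuler ℤ ℤ (Metric.sphere (0 : EuclideanSpace ℝ (Fin 5)) 1) ∅ = 2 := by
  have hS : IsHomologySphere (Metric.sphere (0 : EuclideanSpace ℝ (Fin 5)) 1) 4 :=
    isHomologySphere_sphere (n := 4) (by norm_num)
  haveI : PathConnectedSpace (Metric.sphere (0 : EuclideanSpace ℝ (Fin 5)) 1) := by
    refine isPathConnected_iff_pathConnectedSpace.mp (isPathConnected_sphere ?_ 0 zero_le_one)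
    rw [← Module.finrank_eq_rank, finrank_euclideanSpace_fin]
    exact Nat.one_lt_cast.mpr (by norm_num)
  haveI := singularHomology.isIso_ε_of_pathConnectedSpace ℤ ℤ
    (X := Metric.sphere (0 : EuclideanSpace ℝ (Fin 5)) 1)
  let e0 : singularHomology ℤ ℤ (Metric.sphere (0 : EuclideanSpace ℝ (Fin 5)) 1) 0 ≅
      ModuleCat.of ℤ (ULift.{0} ℤ) :=
    asIso (singularHomology.ε ℤ ℤ (Metric.sphere (0 : EuclideanSpace ℝ (Fin 5)) 1))
  let e4 : singularHomology ℤ ℤ (Metric.sphere (0 : EuclideanSpace ℝ (Fin 5)) 1) 4 ≅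
      ModuleCat.of ℤ (ULift.{0} ℤ) :=
    hS.nonempty_iso.some
  have hZ : ∀ k, k ≠ 0 → k ≠ 4 →
      IsZero (singularHomology ℤ ℤ (Metric.sphere (0 : EuclideanSpace ℝ (Fin 5)) 1) k) :=
    fun k hk0 hk4 => hS.1 k (Nat.pos_of_ne_zero hk0) hk4
  have hfin : ∀ k,
      Module.Finite ℤ (singularHomology ℤ ℤ (Metric.sphere (0 : EuclideanSpace ℝ (Fin 5)) 1) k) := by
    intro k
    by_cases hk0 : k = 0
    · subst hk0; exact Module.Finite.equiv e0.toLinearEquiv.symm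
    by_cases hk4 : k = 4
    · subst hk4; exact Module.Finite.equiv e4.toLinearEquiv.symm
    exact finite_of_isZero (hZ k hk0 hk4)
  have h : FinRelHomology ℤ ℤ (Metric.sphere (0 : EuclideanSpace ℝ (Fin 5)) 1) ∅ 5 :=
    FinRelHomology.empty_of_absolute hfin fun k hk => hZ k (by omega) (by omega)
  refine ⟨h, ?_⟩
  rw [h.relEuler_empty_eq_sum]
  simp only [Finset.sum_range_succ, Finset.sum_range_zero]
  rw [e0.toLinearEquiv.finrank_eq, e4.toLinearEquiv.finrank_eq, finrank_ulift_int,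
    finrank_eq_zero_of_isZero (hZ 1 (by norm_num) (by norm_num)),
    finrank_eq_zero_of_isZero (hZ 2 (by norm_num) (by norm_num)),
    finrank_eq_zero_of_isZero (hZ 3 (by norm_num) (by norm_num))]
  norm_num

/-- **`χ(X) = 2` for `X` homotopy equivalent to `S⁴`** (`X : Type u` in any universe): homotopy
invariance of singular homology (Hatcher 2002, Cor. 2.11; the tree's
`singularHomology.isoOfHomotopyEquiv`, applied to `X ≃ ULift S⁴` inside the universe of `X`)
and invariance of the homology of `S⁴` under the homeomorphism `ULift S⁴ ≃ₜ S⁴` across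
universes (`FinRelHomology.of_homeomorph`, `relEuler_eq_of_homeomorph`).
[cite: HatcherAT2002, Cor. 2.11] -/
theorem finRelHomology_of_homotopyEquiv_sphere_four {X : Type u} [TopologicalSpace X]
    (e : X ≃ₕ (Metric.sphere (0 : EuclideanSpace ℝ (Fin 5)) 1)) :
    FinRelHomology ℤ ℤ X ∅ 5 ∧ relEuler ℤ ℤ X ∅ = 2 := by
  obtain ⟨hS, hSe⟩ := finRelHomology_sphere_four
  -- move `S⁴` into the universe of `X`
  let ψ : ULift.{u} (Metric.sphere (0 : EuclideanSpace ℝ (Fin 5)) 1) ≃ₜ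
      (Metric.sphere (0 : EuclideanSpace ℝ (Fin 5)) 1) := Homeomorph.ulift
  have hY : FinRelHomology ℤ ℤ (ULift.{u} (Metric.sphere (0 : EuclideanSpace ℝ (Fin 5)) 1)) ∅ 5 :=
    hS.of_homeomorph ψ.symm (mapsTo_empty _ _) (mapsTo_empty _ _)
  have hYe : relEuler ℤ ℤ (ULift.{u} (Metric.sphere (0 : EuclideanSpace ℝ (Fin 5)) 1)) ∅ = 2 := by
    rw [← hSe]
    exact (relEuler_eq_of_homeomorph ψ.symm (mapsTo_empty _ _) (mapsTo_empty _ _)).symm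
  -- homotopy invariance inside the universe `u`
  let e' : X ≃ₕ ULift.{u} (Metric.sphere (0 : EuclideanSpace ℝ (Fin 5)) 1) :=
    e.trans ψ.symm.toHomotopyEquiv
  let ek : ∀ k,
      relativeSingularHomology ℤ ℤ (ULift.{u} (Metric.sphere (0 : EuclideanSpace ℝ (Fin 5)) 1)) ∅ k ≅
        relativeSingularHomology ℤ ℤ X ∅ k := fun k =>
    (relativeSingularHomology.emptyIso ℤ ℤ _ k).symm ≪≫
      (singularHomology.isoOfHomotopyEquiv ℤ ℤ e' k).symm ≪≫ relativeSingularHomology.emptyIso ℤ ℤ X k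
  exact ⟨hY.of_iso ek, (relEuler_eq_of_iso ek).symm.trans hYe⟩

/-! ### The theorem -/

/-- `⋃ i, S i = univ` over `Fin 3` unfolds to `S 0 ∪ S 1 ∪ S 2 = univ`. [folklore] -/
theorem union_eq_univ_of_iUnion_fin_three {X : Type u} {S : Fin 3 → Set X}
    (h : (⋃ i, S i) = univ) : S 0 ∪ S 1 ∪ S 2 = univ := by
  refine eq_univ_of_forall fun x => ?_
  have hx : x ∈ ⋃ i, S i := h.symm ▸ mem_univ x
  obtain ⟨i, hi⟩ := mem_iUnion.1 hx
  fin_cases i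
  · exact Or.inl (Or.inl hi)
  · exact Or.inl (Or.inr hi)
  · exact Or.inr hi

/-- `⋂ l, S l` over `Fin 3` unfolds to `S 0 ∩ S 1 ∩ S 2`. [folklore] -/
theorem iInter_fin_three {X : Type u} (S : Fin 3 → Set X) : (⋂ l, S l) = S 0 ∩ S 1 ∩ S 2 := by
  ext x
  refine ⟨fun hx => ⟨⟨mem_iInter.1 hx 0, mem_iInter.1 hx 1⟩, mem_iInter.1 hx 2⟩, fun hx => ?_⟩
  refine mem_iInter.2 fun l => ?_
  fin_cases l
  exacts [hx.1.1, hx.1.2, hx.2]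

/-- **Gay–Kirby 2016, Remark 2 / Meier–Schirmer–Zupan 2016, Remark 3.12, for homotopy
`4`-spheres, PROVED** (discharge of the named fact
`Literature.Topology.FourManifolds.gkTrisection_genus_eq_sum_of_homotopyEquiv_sphere`): a closed
oriented smooth `4`-manifold `X ≃ S⁴` with a `(g; k₀, k₁, k₂)`-trisection (sectors with corners,
`IsGKTrisection`) has `g = k₀ + k₁ + k₂`.  Proof: inclusion–exclusion of the rational Čech Euler
characteristic over the closed cover by the three sectors, tautness of the compact pieces, the
Morse equalities for the handlebodies and the central surface, and `χ(X) = χ(S⁴) = 2` (module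
docstring). [cite: GayKirby2016, Remark 2] -/
theorem gkTrisection_genus_eq_sum_of_homotopyEquiv_sphere_holds :
    gkTrisection_genus_eq_sum_of_homotopyEquiv_sphere.{u} := by
  intro X _ _ _ _ _ _ _ g k S hT e
  -- the rational coefficient object
  let Qu : ModuleCat.{u} ℚ := ModuleCat.of ℚ (ULift.{u} ℚ)
  -- `X` embeds in some `ℝᵐ` as a neighbourhood retract (compact manifolds are ENRs)
  obtain ⟨m, ι, hιc⟩ :=
    Literature.Geometry.Manifold.exists_isClosedEmbedding_pi_of_compactSpace
      (EuclideanSpace ℝ (Fin 4)) (M := X)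
  have hι : IsEmbedding ι := hιc.isEmbedding
  have hX : IsNeighbourhoodRetract (range ι) :=
    isNeighbourhoodRetract_range_of_compactSpace isNeighbourhoodRetract_of_locallyContractibleSpace_holds
      (EuclideanSpace ℝ (Fin 4)) hι
  obtain ⟨hcov, hsec, hpair⟩ := hT
  have hKc : ∀ i, IsCompact (S i) := fun i =>
    IsGKTrisection.isCompact (X := X) ⟨hcov, hsec, hpair⟩ i
  -- (a) the sectors: `χ̌(S i) = χ(W_i) = 1 - k i`
  have hSec : ∀ i, Cech.FinCech ℚ Qu (S i) 5 ∧ Cech.euler ℚ Qu (S i) = 1 - (k i : ℤ) := by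
    intro i
    obtain ⟨W, _, _, f, hM, hW, -, hh, hf, hrange, -⟩ := hsec i
    haveI := hM; haveI := hW
    haveI : T2Space W := hf.t2Space
    haveI : SecondCountableTopology W := hf.secondCountableTopology
    let φ : ↥(S i) ≃ₜ W := (hf.toHomeomorph.trans (Homeomorph.setCongr hrange)).symm
    obtain ⟨hP, hPe⟩ := relEuler_of_handleCount hh
    obtain ⟨hF, hFe⟩ := finCech_and_euler_of_homeomorph hι hX (hKc i) φ
      (locallyContractibleSpace_of_chartedSpace_halfSpace 4 W) hP
    exact ⟨hF, hFe.trans hPe⟩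
  -- (b) the double intersections and (c) the central surface
  have hPair : ∀ i j, i ≠ j →
      (Cech.FinCech ℚ Qu (S i ∩ S j) 5 ∧ Cech.euler ℚ Qu (S i ∩ S j) = 1 - (g : ℤ)) ∧
      (Cech.FinCech ℚ Qu (⋂ l, S l) 5 ∧ Cech.euler ℚ Qu (⋂ l, S l) = 2 - 2 * (g : ℤ)) := by
    intro i j hij
    obtain ⟨H, _, _, h, hM, hH, -, hh, hf, hrange, hbd⟩ := hpair i j hij
    haveI := hM; haveI := hH
    haveI : T2Space H := hf.isEmbedding.t2Space
    haveI : SecondCountableTopology H := hf.isEmbedding.secondCountableTopology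
    have hKij : IsCompact (S i ∩ S j) := (hKc i).inter_right (hKc j).isClosed
    have hKI : IsCompact (⋂ l, S l) :=
      IsGKTrisection.isCompact_iInter (X := X) ⟨hcov, hsec, hpair⟩
    constructor
    · let φ : ↥(S i ∩ S j) ≃ₜ H :=
        (hf.isEmbedding.toHomeomorph.trans (Homeomorph.setCongr hrange)).symm
      obtain ⟨hP, hPe⟩ := relEuler_of_handleCount hh
      obtain ⟨hF, hFe⟩ := finCech_and_euler_of_homeomorph hι hX hKij φ
        (locallyContractibleSpace_of_chartedSpace_halfSpace 3 H) (hP.mono (show 2 + 2 ≤ 5 by norm_num))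
      exact ⟨hF, hFe.trans hPe⟩
    · let φ : ↥(⋂ l, S l) ≃ₜ ((𝓡∂ 3).boundary H) :=
        ((hf.isEmbedding.homeomorphImage ((𝓡∂ 3).boundary H)).trans
          (Homeomorph.setCongr hbd)).symm
      obtain ⟨hP, hPe⟩ := relEuler_boundary_of_handleCount hh
      obtain ⟨hF, hFe⟩ := finCech_and_euler_of_homeomorph hι hX hKI φ
        (locallyContractibleSpace_of_chartedSpace (EuclideanSpace ℝ (Fin 2))
          (M := (𝓡∂ 3).boundary H)) (hP.mono (show 2 + 2 ≤ 5 by norm_num))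
      refine ⟨hF, hFe.trans ?_⟩
      rw [hPe]
      ring
  -- (d) `X` itself: `χ̌(X) = χ(X) = χ(S⁴) = 2`
  have hUniv : Cech.FinCech ℚ Qu (univ : Set X) 5 ∧ Cech.euler ℚ Qu (univ : Set X) = 2 := by
    obtain ⟨hP, hPe⟩ := finRelHomology_of_homotopyEquiv_sphere_four e
    obtain ⟨hF, hFe⟩ := finCech_and_euler_of_homeomorph hι hX isCompact_univ
      (Homeomorph.Set.univ X)
      (locallyContractibleSpace_of_chartedSpace (EuclideanSpace ℝ (Fin 4)) (M := X)) hP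
    exact ⟨hF, hFe.trans hPe⟩
  -- inclusion–exclusion over the cover `X = S 0 ∪ S 1 ∪ S 2`
  have hU : S 0 ∪ S 1 ∪ S 2 = univ := union_eq_univ_of_iUnion_fin_three hcov
  have hI : (⋂ l, S l) = S 0 ∩ S 1 ∩ S 2 := iInter_fin_three S
  obtain ⟨f₀₁, e₀₁⟩ := (hPair 0 1 (by decide)).1
  obtain ⟨f₀₂, e₀₂⟩ := (hPair 0 2 (by decide)).1
  obtain ⟨f₁₂, e₁₂⟩ := (hPair 1 2 (by decide)).1
  obtain ⟨fI, eI⟩ := (hPair 0 1 (by decide)).2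
  rw [hI] at fI eI
  obtain ⟨-, hχ⟩ := Cech.euler_union₃ (hKc 0) (hKc 1) (hKc 2) (hSec 0).1 (hSec 1).1 (hSec 2).1
    f₀₁ f₀₂ f₁₂ fI
  rw [hU, hUniv.2, (hSec 0).2, (hSec 1).2, (hSec 2).2, e₀₁, e₀₂, e₁₂, eI] at hχ
  have hg : (g : ℤ) = k 0 + k 1 + k 2 := by linarith
  exact_mod_cast hg

end Literature.Topology.FourManifolds

end
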